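import Literature.Topology.FourManifolds.TrisectionFunctorGK
import Literature.Topology.FourManifolds.TrisectionsRefutation
import Literature.Topology.FourManifolds.SphereSimplyConnected
import HarnessLib

/-!
# The standard trisections of the round `S⁴` (Gay–Kirby 2016, §2): reduction to the genus-`0` example

Topic `Literature/Topology/FourManifolds`; companion to `TrisectionFunctorGK.lean` (fact item
`provefact-Literature.sphere_trisections`).  Fact (d) of `TrisectionFunctor.lean`,
`Literature.Topology.FourManifolds.sphere_trisections`, is false as stated (`Literature.Topology.FourManifolds.not_sphere_trisections`,
`TrisectionFunctorProofs.lean`: it is an existential over the unsatisfiable predicate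
`Literature.Topology.FourManifolds.IsBalancedTrisection`); its corrected form is the named fact `Literature.Topology.FourManifolds.sphere_gkTrisections` (d′)
of `TrisectionFunctorGK.lean`, over Gay–Kirby trisections with corners along the central surface
(`Literature.Topology.FourManifolds.IsBalancedGKTrisection`, `Trisections.lean`): for every `m` the round `S⁴ ⊆ ℝ⁵` carries a
balanced `(3 + 3m, 1 + m)`-trisection with a marking of the central surface whose
Abrams–Gay–Kirby kernel triple is isomorphic to `s4Kernels.stabilizeIter m`.

This file carries out the printed architecture of (d′) (Gay–Kirby 2016, §2, arXiv p. 5):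

1. "`S⁴ ⊂ ℂ × ℝ³` can be explicitly divided into three pieces
   `X_j = {(re^{iθ}, x₃, x₄, x₅) | 2πj/3 ≤ θ ≤ 2π(j+1)/3}`, giving a genus `0` trisection of `S⁴`."
   — vendored as the named fact `Literature.Topology.FourManifolds.sphereSector_isBalancedGKTrisection` about the explicit
   sectors `Literature.GayKirby.sphereSector j` (not proved in THIS file: it needs the corner charts, the
   handle decompositions of the sectors `≅ B⁴` and of the double intersections `≅ B³`, all spelled
   out in the docstring of `Literature.Topology.FourManifolds.IsGKTrisection`; DISCHARGED in the sibling proof files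
   `SphereTrisectionsHandlebodies.lean` (clause (iii)) and `SphereTrisectionsSectors.lean`
   (clause (ii) and `Literature.Topology.FourManifolds.sphereSector_isBalancedGKTrisection_holds`)), with the abstract corollary
   `Literature.Topology.FourManifolds.sphere_genusZero_gkTrisection` (`∃ S, IsBalancedGKTrisection S⁴ 0 0 S`; discharged as
   `Literature.Topology.FourManifolds.sphere_genusZero_gkTrisection_holds` in `SphereTrisectionsSectors.lean`).
2. "Stabilizing the genus `0` trisection of `S⁴` gives a genus `3` trisection […] the standard
   genus `3` trisection of `S⁴`"; "Stabilization can then also be defined as performing a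
   connected sum with `S⁴` with its standard genus `3` trisection" (ibid.), a stabilisation of a
   `(g, k)`-trisection of `X` being a `(g + 3, k + 1)`-trisection of `X` (Def. 8, Lemma 10,
   arXiv p. 4) whose kernel triple is the algebraic stabilisation of the old one
   (Abrams–Gay–Kirby 2018, Def. 3 and Thm. 5) — this is the tree's named fact (c′)
   `Literature.Topology.FourManifolds.exists_stabilized_gkTrisection`.
3. The algebra, PROVED here: the kernel triple of any genus-`0` trisection is `trivialKernels`
   (`S_0 = {1}`; `groupGKTrisectionOf_genus_zero`), the algebraic stabilisation of
   `trivialKernels` is the genus-`3` `S⁴` triple on the nose (`trivialKernels_stabilize :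
   trivialKernels.stabilize = s4Kernels`, via `genShift_zero`), and a kernel triple isomorphic
   to `K` is equal to `K` after changing the marking (`groupGKTrisectionOf_symm_trans`,
   `exists_marking_groupGKTrisectionOf_eq`), so that (c′) can be iterated.

**Main results.** `Literature.Topology.FourManifolds.sphere_gkTrisections_of_genusZero`: (d′) follows from the genus-`0`
trisection of `S⁴` (1.), the marking fact (g′) `Literature.Topology.FourManifolds.exists_marking_centralSurface_of_gkTrisection`
(used once, to mark the `2`-sphere `F` of the genus-`0` trisection) and the stabilisation fact
(c′), by induction on `m`; the orientation of `S⁴` demanded by (g′), (c′) is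
`Literature.Topology.FourManifolds.isOrientable_sphere_holds`.  Also `Literature.Topology.FourManifolds.sphere_gkTrisectionGenus_eq_zero`: under 1. the
(corrected) trisection genus of `S⁴` is `0`.

For the explicit sectors the marking fact is not needed:
`Literature.Topology.FourManifolds.GayKirby.iInter_sphereSector_eq` computes the central surface `X₀ ∩ X₁ ∩ X₂ = {z = 0} ∩ S⁴`
(print: "The diagram is `S²` with no curves"), which is the isometric image of the unit sphere of
`ℝ³` and hence simply connected (`Literature.Topology.FourManifolds.GayKirby.isSimplyConnected_iInter_sphereSector`, from
`Literature.Topology.FourManifolds.simplyConnectedSpace_euclideanSphere`, Hatcher Prop. 1.14), so `S_0 = {1} ≃* π₁(F, e₂)`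
(`Literature.Topology.FourManifolds.GayKirby.sphereSector_marking`); whence `Literature.Topology.FourManifolds.sphere_gkTrisections_of_sphereSector_of_stabilization`:
(d′) follows from the two geometric named facts `sphereSector_isBalancedGKTrisection` (GK §2,
first example) and `exists_stabilized_gkTrisection` (c′) alone
(via `Literature.Topology.FourManifolds.sphere_gkTrisections_of_marked_genusZero`).

Finally the genus-`0` fact is split into the three clauses (i)–(iii) of `Literature.Topology.FourManifolds.IsGKTrisection`
(Gay–Kirby's Def. 1 consists of a preamble — "a decomposition of `X` into three submanifolds
`X = X_1 ∪ X_2 ∪ X_3`", clause (i) — and two bullets: "For each `i = 1,2,3`, there is a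
diffeomorphism `φ_i : X_i → Z_k`" (`Z_k = ♮^k (S¹ × B³)`; clause (ii)) and "For each `i = 1,2,3`,
taking indices mod `3`, `φ_i(X_i ∩ X_{i+1}) = Y⁻_{k,g}` and `φ_i(X_i ∩ X_{i-1}) = Y⁺_{k,g}`",
followed by the paragraph "consider the handlebodies `H_{ij} = X_i ∩ X_j` and the central genus `g`
surface `F_g = X_1 ∩ X_2 ∩ X_3 = ∂H_{ij}`" (clause (iii)); arXiv p. 3): clause (i)
(`S⁴ = X₀ ∪ X₁ ∪ X₂`) is PROVED here (`Literature.Topology.FourManifolds.GayKirby.iUnion_sphereSector_eq_univ`, polar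
coordinates), clauses (ii) (the sectors are `4`-balls with corners along `F`) and (iii) (the double
intersections are `3`-balls bounded by `F`) are the named facts `Literature.Topology.FourManifolds.sphereSector_sectors`,
`Literature.Topology.FourManifolds.sphereSector_handlebodies` — DISCHARGED in the sibling proof files `SphereTrisectionsSectors.lean`
(`Literature.Topology.FourManifolds.sphereSector_sectors_holds`, via the explicit parametrisation `GayKirby.sectorMap` of `X_j` by
the closed unit `4`-ball) and `SphereTrisectionsHandlebodies.lean`
(`Literature.Topology.FourManifolds.sphereSector_handlebodies_holds`) — and `Literature.Topology.FourManifolds.sphereSector_isBalancedGKTrisection_of` /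
`Literature.Topology.FourManifolds.sphere_gkTrisections_of_clauses` assemble them: (d′) ⇐ (ii) + (iii) + (c′); with (ii), (iii)
discharged, (d′) ⇐ (c′) alone (`Literature.Topology.FourManifolds.sphere_gkTrisections_of_stabilization`,
`SphereTrisectionsSectors.lean`).  Towards (ii), (iii):
the double intersections are computed (`Literature.Topology.FourManifolds.GayKirby.sphereSector_zero_inter_one`,
`sphereSector_one_inter_two`, `sphereSector_two_inter_zero`: the closed half great-`3`-spheres
`{(s e^{iβ}, x) | s ≥ 0}`, `β = 2π/3, 4π/3, 0`), via the elementary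
`Literature.Topology.FourManifolds.GayKirby.exists_ray_of_mem_adjacent_sectors`.

## References

* D. Gay, R. Kirby, *Trisecting 4-manifolds*, Geom. Topol. 20 (2016) 3097–3132 (arXiv:1205.1565,
  whose pagination is quoted): Def. 1 (arXiv p. 3); Def. 8 (stabilisation), Def. 9, Lemma 10
  (arXiv p. 4); §2, first three examples (arXiv p. 5).
* A. Abrams, D. Gay, R. Kirby, *Group trisections and smooth 4-manifolds*, Geom. Topol. 22 (2018)
  1537–1545: Def. 3 (p. 1540), Thm. 5 (p. 1541: "The unique `(0, 0)`-trisection of `{1}` maps to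
  the unique `(0, 0)`-trisection of `S⁴`, the standard `(3, 1)`-trisection of `{1}` maps to the
  standard `(3, 1)`-trisection of `S⁴`, and connected sums of group trisections map to connected
  sums of 4-manifold trisections").
* A. Hatcher, *Algebraic Topology*, CUP 2002, Prop. 1.14 (`π₁(Sⁿ) = 0` for `n ≥ 2`).
-/

noncomputable section

open Set
open scoped Manifold ContDiff Real

namespace Literature.Topology.FourManifolds

/-! ### Algebra: genus `0` kernel triples and their stabilisation -/

section Algebra

/-- On generators, the shift `S_3 → S_{0+3}` of `genShift 0` is the identity (`Fin.natAdd 0 = id`),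
so `genShift 0` is the identity of the free group `F(a₁, b₁, a₂, b₂, a₃, b₃)`. [folklore] -/
theorem genShift_zero : genShift 0 = MonoidHom.id (FreeGroup (surfaceGen 3)) := by
  refine FreeGroup.ext_hom _ _ fun p => ?_
  simp only [genShift, FreeGroup.map.of, MonoidHom.id_apply]
  congr 1
  exact Prod.ext (Fin.ext (Nat.zero_add _)) rfl

/-- **The stabilisation of the trivial genus-`0` triple is the genus-`3` `S⁴` triple**, on the nose:
`trivialKernels.stabilize i = ⟪(lifts of) S_0 = {1} on no handles, s4Kernels i on the three new
handles⟫ = s4Kernels i` (Abrams–Gay–Kirby 2018, Def. 3: "The stabilization of a group trisection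
is the connected sum of the given trisection with the standard trivial `(3, 1)`-trisection", and
the `(0, 0)`-trisection is the unit for connected sum). [cite: AbramsGayKirby2018, Def. 3 (p. 1540)] -/
theorem trivialKernels_stabilize : trivialKernels.stabilize = s4Kernels := by
  funext i
  haveI : (s4Kernels i).Normal := s4Kernels_isGroupTrisection_holds.normal i
  -- the generating set of the stabilised kernel lies in `s4Kernels i` …
  have hsub : stabSet ((trivialKernels i : Subgroup (SurfaceGroup 0)) : Set (SurfaceGroup 0))
      (s4Kernels i : Set (SurfaceGroup 3)) ⊆ (s4Kernels i : Set (SurfaceGroup 3)) := by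
    rintro x (⟨w, -, rfl⟩ | ⟨w, hw, rfl⟩)
    · -- `w ∈ F(∅) = {1}`
      simp only [Function.comp_apply, Subsingleton.elim w 1, map_one]
      exact one_mem _
    · rw [Set.mem_preimage] at hw
      rw [Function.comp_apply, genShift_zero]
      exact hw
  -- … and contains it
  have hsup : (s4Kernels i : Set (SurfaceGroup 3)) ⊆ stabSet
      ((trivialKernels i : Subgroup (SurfaceGroup 0)) : Set (SurfaceGroup 0))
      (s4Kernels i : Set (SurfaceGroup 3)) := by
    intro x hx
    obtain ⟨w, rfl⟩ := PresentedGroup.mk_surjective _ x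
    refine Or.inr ⟨w, hx, ?_⟩
    rw [Function.comp_apply, genShift_zero]
    rfl
  rw [TrisectionKernels.stabilize_apply]
  exact le_antisymm (Subgroup.normalClosure_le_normal hsub)
    (fun x hx => Subgroup.subset_normalClosure (hsup hx))

end Algebra

section Functor

universe u

variable {X : Type u} [TopologicalSpace X] [ChartedSpace (EuclideanSpace ℝ (Fin 4)) X]
  {g : ℕ} {k : Fin 3 → ℕ} {S : Fin 3 → Set X}

/-- **The kernel triple of a genus-`0` trisection is the trivial triple** `(⊤, ⊤, ⊤)`: `S_0 = {1}`
(Abrams–Gay–Kirby 2018, Thm. 5: "The unique `(0, 0)`-trisection of `{1}` maps to the unique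
`(0, 0)`-trisection of `S⁴`"). [cite: AbramsGayKirby2018, Thm. 5 (p. 1541)] -/
theorem groupGKTrisectionOf_genus_zero {k : Fin 3 → ℕ} (h : IsGKTrisection X 0 k S)
    (x₀ : centralSurface S) (μ : SurfaceGroup 0 ≃* FundamentalGroup (centralSurface S) x₀) :
    groupGKTrisectionOf h x₀ μ = trivialKernels := by
  funext i
  ext γ
  simp only [trivialKernels, Subgroup.mem_top, iff_true]
  rw [Subsingleton.elim γ 1]
  exact one_mem _

/-- **Re-marking realises isomorphisms of kernel triples exactly.**  Precomposing the marking with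
`α⁻¹` replaces each kernel `Kᵢ` by its image `α(Kᵢ)`. [cite: AbramsGayKirby2018, Def. 1 (p. 1538, isomorphism of trisections)] -/
theorem groupGKTrisectionOf_symm_trans (h : IsGKTrisection X g k S) (x₀ : centralSurface S)
    (μ : SurfaceGroup g ≃* FundamentalGroup (centralSurface S) x₀)
    (α : SurfaceGroup g ≃* SurfaceGroup g) (i : Fin 3) :
    groupGKTrisectionOf h x₀ (α.symm.trans μ) i = (groupGKTrisectionOf h x₀ μ i).map α.toMonoidHom := by
  ext γ
  simp only [mem_groupGKTrisectionOf_iff, MulEquiv.trans_apply, Subgroup.mem_map,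
    MulEquiv.coe_toMonoidHom]
  constructor
  · intro hγ
    exact ⟨α.symm γ, hγ, by simp⟩
  · rintro ⟨δ, hδ, rfl⟩
    simpa using hδ

/-- Consequently a kernel triple *isomorphic* to `K` becomes *equal* to `K` for another marking of
the same central surface at the same base point (so named facts concluding
`Iso (groupGKTrisectionOf h x₀ μ) K` may be fed back into hypotheses about
`groupGKTrisectionOf h x₀ μ'`). [cite: AbramsGayKirby2018, Def. 1 (p. 1538, isomorphism of trisections)] -/
theorem exists_marking_groupGKTrisectionOf_eq (h : IsGKTrisection X g k S) (x₀ : centralSurface S)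
    (μ : SurfaceGroup g ≃* FundamentalGroup (centralSurface S) x₀) {K : TrisectionKernels g}
    (hK : TrisectionKernels.Iso (groupGKTrisectionOf h x₀ μ) K) :
    ∃ μ' : SurfaceGroup g ≃* FundamentalGroup (centralSurface S) x₀, groupGKTrisectionOf h x₀ μ' = K := by
  obtain ⟨α, hα⟩ := hK
  exact ⟨α.symm.trans μ, funext fun i => (groupGKTrisectionOf_symm_trans h x₀ μ α i).trans (hα i)⟩

end Functor

/-! ### The genus-`0` trisection of the round `S⁴` (Gay–Kirby 2016, §2, first example) -/

/-- **Gay–Kirby's sectors of the round `S⁴`.**  Viewing `ℝ⁵ = ℂ × ℝ³` with `z = x₀ + i x₁`, the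
`j`-th sector (`j = 0, 1, 2`) is `X_j = {(r e^{iθ}, x₂, x₃, x₄) ∈ S⁴ | r ≥ 0, 2πj/3 ≤ θ ≤ 2π(j+1)/3}`
(print: "`X_j = {(re^{iθ}, x₃, x₄, x₅) | 2πj/3 ≤ θ ≤ 2π(j+1)/3}`", coordinates numbered from `1`
there and from `0` here).  The points with `r = 0` (the `2`-sphere `{z = 0} ∩ S⁴`) lie in all three
sectors. [cite: GayKirby2016, §2 (arXiv p. 5), first example] -/
def GayKirby.sphereSector (j : Fin 3) : Set (Metric.sphere (0 : EuclideanSpace ℝ (Fin 5)) 1) :=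
  {x | ∃ r θ : ℝ, 0 ≤ r ∧ 2 * π * (j : ℕ) / 3 ≤ θ ∧ θ ≤ 2 * π * ((j : ℕ) + 1) / 3 ∧
    (x : EuclideanSpace ℝ (Fin 5)) 0 = r * Real.cos θ ∧ (x : EuclideanSpace ℝ (Fin 5)) 1 = r * Real.sin θ}

/-- Unfolding of `GayKirby.sphereSector`. [cite: GayKirby2016, §2 (arXiv p. 5), first example] -/
theorem GayKirby.mem_sphereSector_iff (j : Fin 3) (x : Metric.sphere (0 : EuclideanSpace ℝ (Fin 5)) 1) :
    x ∈ GayKirby.sphereSector j ↔ ∃ r θ : ℝ, 0 ≤ r ∧ 2 * π * (j : ℕ) / 3 ≤ θ ∧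
      θ ≤ 2 * π * ((j : ℕ) + 1) / 3 ∧ (x : EuclideanSpace ℝ (Fin 5)) 0 = r * Real.cos θ ∧
      (x : EuclideanSpace ℝ (Fin 5)) 1 = r * Real.sin θ :=
  Iff.rfl

/-- The `2`-sphere `{z = 0} ∩ S⁴` lies in every sector (take `r = 0` and `θ` the left end-point
of the `j`-th arc). [cite: GayKirby2016, §2 (arXiv p. 5), first example] -/
theorem GayKirby.mem_sphereSector_of_eq_zero {x : Metric.sphere (0 : EuclideanSpace ℝ (Fin 5)) 1}
    (h0 : (x : EuclideanSpace ℝ (Fin 5)) 0 = 0) (h1 : (x : EuclideanSpace ℝ (Fin 5)) 1 = 0) (j : Fin 3) :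
    x ∈ GayKirby.sphereSector j := by
  have hπ : 0 < π := Real.pi_pos
  exact ⟨0, 2 * π * (j : ℕ) / 3, le_rfl, le_rfl, by linarith, by simp [h0], by simp [h1]⟩

/-- **Named fact (Gay–Kirby 2016, §2, first example): the genus-`0` trisection of `S⁴`.**  The three
sectors `X_j = {2πj/3 ≤ θ ≤ 2π(j+1)/3}` of the unit sphere `S⁴ ⊂ ℂ × ℝ³ = ℝ⁵` (Mathlib's smooth
structure on `Metric.sphere 0 1`) form a balanced `(0, 0)`-trisection in the sense of Gay–Kirby's
Def. 1 read with corners along the central surface (`IsBalancedGKTrisection`): each `X_j` is a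
`4`-ball with corners along `F = {z = 0} ∩ S⁴ = S²` (one `0`-handle, no `1`-handles), the double
intersections `X_j ∩ X_{j+1} = {θ = 2π(j+1)/3} ∪ F` are closed hemispheres of great `3`-spheres,
i.e. `3`-balls (genus-`0` handlebodies) with boundary `F`.  Print: "`S⁴ ⊂ ℂ × ℝ³` can be explicitly
divided into three pieces `X_j = {(re^{iθ}, x₃, x₄, x₅) | 2πj/3 ≤ θ ≤ 2π(j+1)/3}`, giving a genus
`0` trisection of `S⁴`. The diagram is `S²` with no curves."  The clause-by-clause verification
against `IsGKTrisection` (corner charts `cornerFold ∘ A_j⁻¹ ∘ Ψ`, the Morse functions exhibiting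
`X_j ≅ B⁴` and `X_j ∩ X_{j+1} ≅ B³`) is written out in the docstring of `Literature.Topology.FourManifolds.IsGKTrisection`
(`Trisections.lean`, "Non-vacuity"); it is not formalised in this file, where the statement is
recorded as a named fact — DISCHARGED in `SphereTrisectionsSectors.lean`
(`Literature.Topology.FourManifolds.sphereSector_isBalancedGKTrisection_holds`).  **Superseded** as an independent input by its
clauses: it is equivalent to the conjunction of the named facts `sphereSector_sectors` (clause (ii))
and `sphereSector_handlebodies` (clause (iii)), clause (i) being proved
(`sphereSector_isBalancedGKTrisection_of`, `sphereSector_isBalancedGKTrisection.clauses` below);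
clause (iii) is discharged in `SphereTrisectionsHandlebodies.lean`, clause (ii) in
`SphereTrisectionsSectors.lean`.
[cite: GayKirby2016, §2 (arXiv p. 5), first example; Def. 1 (arXiv p. 3)] -/
def sphereSector_isBalancedGKTrisection : Prop :=
  IsBalancedGKTrisection (Metric.sphere (0 : EuclideanSpace ℝ (Fin 5)) 1) 0 0 GayKirby.sphereSector

/-- **Corollary form: the round `S⁴` has a genus-`0` trisection** (with corners along the central
surface).  Named fact; DISCHARGED in `SphereTrisectionsSectors.lean`
(`Literature.Topology.FourManifolds.sphere_genusZero_gkTrisection_holds`). [cite: GayKirby2016, §2 (arXiv p. 5), first example] -/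
def sphere_genusZero_gkTrisection : Prop :=
  ∃ S : Fin 3 → Set (Metric.sphere (0 : EuclideanSpace ℝ (Fin 5)) 1),
    IsBalancedGKTrisection (Metric.sphere (0 : EuclideanSpace ℝ (Fin 5)) 1) 0 0 S

/-- The explicit fact gives the abstract one. [cite: GayKirby2016, §2 (arXiv p. 5), first example] -/
theorem sphereSector_isBalancedGKTrisection.sphere_genusZero_gkTrisection
    (h : sphereSector_isBalancedGKTrisection) : sphere_genusZero_gkTrisection :=
  ⟨_, h⟩

/-- Under the genus-`0` fact the (corrected) trisection genus of the round `S⁴` is `0`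
(Gay–Kirby 2016, Remark 2 and §2). [cite: GayKirby2016, §2 (arXiv p. 5), first example] -/
theorem sphere_gkTrisectionGenus_eq_zero (h : sphere_genusZero_gkTrisection) :
    gkTrisectionGenus (Metric.sphere (0 : EuclideanSpace ℝ (Fin 5)) 1) = 0 := by
  obtain ⟨S, hS⟩ := h
  exact nonpos_iff_eq_zero.mp (by exact_mod_cast gkTrisectionGenus_le hS.isGKTrisection)

/-! ### (d′) from the genus-`0` trisection, the marking fact (g′) and stabilisation (c′) -/

/-- The round `4`-sphere is connected (`dim ℝ⁵ > 1`). [folklore] -/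
instance connectedSpace_sphere_four :
    ConnectedSpace (Metric.sphere (0 : EuclideanSpace ℝ (Fin 5)) 1) := by
  refine isConnected_iff_connectedSpace.mp (isConnected_sphere ?_ 0 zero_le_one)
  rw [← Module.finrank_eq_rank, finrank_euclideanSpace_fin]
  norm_num

/-- **(d′) reduces to the genus-`0` example (Gay–Kirby 2016, §2).**  Assume: the round `S⁴` has a
genus-`0` trisection with corners (`sphere_genusZero_gkTrisection`, GK §2 first example); central
surfaces of balanced Gay–Kirby trisections of closed oriented 4-manifolds can be marked ((g′),
`exists_marking_centralSurface_of_gkTrisection`, used only for the `2`-sphere `F` of the genus-`0`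
trisection); and stabilisation ((c′), `exists_stabilized_gkTrisection`: a `(g, k)`-trisection of
`X` yields a `(g + 3, k + 1)`-trisection of `X` with kernel triple isomorphic to the algebraic
stabilisation, GK Def. 8 / Lemma 10 and AGK Def. 3 / Thm. 5).  Then for every `m` the round `S⁴`
has a balanced `(3 + 3m, 1 + m)`-trisection with a marking whose kernel triple is isomorphic to
`s4Kernels.stabilizeIter m` — the named fact `sphere_gkTrisections`.  Proof, as printed ("Stabilizing
the genus `0` trisection of `S⁴` gives a genus `3` trisection […] the standard genus `3`
trisection of `S⁴`", then iterate): induction on `m`; the genus-`0` kernel triple is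
`trivialKernels` (`groupGKTrisectionOf_genus_zero`) whose stabilisation is `s4Kernels`
(`trivialKernels_stabilize`); in the inductive step the isomorphism
`Iso (groupGKTrisectionOf h x₀ μ) (s4Kernels.stabilizeIter m)` is first made an equality by
re-marking (`exists_marking_groupGKTrisectionOf_eq`), then (c′) is applied; `S⁴` is oriented by
`isOrientable_sphere_holds`. [cite: GayKirby2016, §2 (arXiv p. 5), first three examples; Def. 8 and Lemma 10 (arXiv p. 4)]
[cite: AbramsGayKirby2018, Thm. 5 (p. 1541)] -/
theorem sphere_gkTrisections_of_genusZero (h0 : sphere_genusZero_gkTrisection)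
    (hg : exists_marking_centralSurface_of_gkTrisection.{0})
    (hc : exists_stabilized_gkTrisection.{0}) : sphere_gkTrisections := by
  obtain ⟨o⟩ := isOrientable_sphere_holds 4
  intro m
  induction m with
  | zero =>
    obtain ⟨S₀, hS₀⟩ := h0
    obtain ⟨x₀, ⟨μ₀⟩⟩ := hg (Metric.sphere (0 : EuclideanSpace ℝ (Fin 5)) 1) o 0 0 S₀ hS₀
    obtain ⟨S₁, hS₁, x₁, μ₁, hiso⟩ :=
      hc (Metric.sphere (0 : EuclideanSpace ℝ (Fin 5)) 1) o 0 0 S₀ hS₀ x₀ μ₀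
    rw [groupGKTrisectionOf_genus_zero, trivialKernels_stabilize] at hiso
    exact ⟨S₁, hS₁, x₁, μ₁, hiso⟩
  | succ m ih =>
    obtain ⟨S, hS, x₀, μ, hiso⟩ := ih
    obtain ⟨μ', hμ'⟩ := exists_marking_groupGKTrisectionOf_eq hS x₀ μ hiso
    obtain ⟨S', hS', x₀', μ'', hiso'⟩ :=
      hc (Metric.sphere (0 : EuclideanSpace ℝ (Fin 5)) 1) o (3 + 3 * m) (1 + m) S hS x₀ μ'
    rw [hμ'] at hiso'
    exact ⟨S', hS', x₀', μ'', hiso'⟩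

/-- The same reduction from the explicit genus-`0` trisection of Gay–Kirby.
[cite: GayKirby2016, §2 (arXiv p. 5), first three examples] -/
theorem sphere_gkTrisections_of_sphereSector (h0 : sphereSector_isBalancedGKTrisection)
    (hg : exists_marking_centralSurface_of_gkTrisection.{0})
    (hc : exists_stabilized_gkTrisection.{0}) : sphere_gkTrisections :=
  sphere_gkTrisections_of_genusZero h0.sphere_genusZero_gkTrisection hg hc


/-! ### The central surface of Gay–Kirby's sectors is the `2`-sphere `{z = 0}`; (d′) without (g′) -/

namespace GayKirby

/-- A point lying in all three sectors has `z = x₀ + i x₁ = 0`: from `X₀` (`0 ≤ θ ≤ 2π/3`) we get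
`x₁ ≥ 0`, from `X₂` (`4π/3 ≤ θ ≤ 2π`) `x₁ ≤ 0`, so `x₁ = 0`; from `X₁` (`2π/3 ≤ θ ≤ 4π/3`)
`x₀ ≤ 0`, and `x₁ = 0` on `X₀` forces `r = 0` or `θ = 0`, whence `x₀ ≥ 0` (Gay–Kirby: the triple
intersection is the `2`-sphere `{z = 0}`, "The diagram is `S²` with no curves").
[cite: GayKirby2016, §2 (arXiv p. 5), first example] -/
theorem eq_zero_of_forall_mem_sphereSector {x : Metric.sphere (0 : EuclideanSpace ℝ (Fin 5)) 1}
    (hx : ∀ j, x ∈ sphereSector j) :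
    (x : EuclideanSpace ℝ (Fin 5)) 0 = 0 ∧ (x : EuclideanSpace ℝ (Fin 5)) 1 = 0 := by
  have hπ : 0 < π := Real.pi_pos
  obtain ⟨r₀, θ₀, hr₀, h₀l, h₀u, hx₀, hy₀⟩ := hx 0
  obtain ⟨r₁, θ₁, hr₁, h₁l, h₁u, hx₁, -⟩ := hx 1
  obtain ⟨r₂, θ₂, hr₂, h₂l, h₂u, -, hy₂⟩ := hx 2
  simp only [Fin.val_zero, Nat.cast_zero, mul_zero, zero_div, zero_add, mul_one] at h₀l h₀u
  simp only [Fin.val_one, Nat.cast_one, mul_one] at h₁l h₁u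
  simp only [Fin.val_two, Nat.cast_ofNat] at h₂l h₂u
  -- `x₁ = 0`
  have hsin₀ : 0 ≤ Real.sin θ₀ := Real.sin_nonneg_of_nonneg_of_le_pi h₀l (by linarith)
  have hsin₂ : Real.sin θ₂ ≤ 0 := by
    have h := Real.sin_nonneg_of_nonneg_of_le_pi (x := θ₂ - π) (by linarith) (by linarith)
    rw [Real.sin_sub_pi] at h
    linarith
  have hy : (x : EuclideanSpace ℝ (Fin 5)) 1 = 0 :=
    le_antisymm (hy₂ ▸ mul_nonpos_iff.mpr (Or.inl ⟨hr₂, hsin₂⟩)) (hy₀ ▸ mul_nonneg hr₀ hsin₀)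
  refine ⟨le_antisymm ?_ ?_, hy⟩
  · -- `x₀ ≤ 0` from `X₁`
    rw [hx₁]
    exact mul_nonpos_iff.mpr (Or.inl ⟨hr₁,
      Real.cos_nonpos_of_pi_div_two_le_of_le (by linarith) (by linarith)⟩)
  · -- `x₀ ≥ 0` from `X₀` and `x₁ = 0`
    rw [hx₀]
    rcases hr₀.eq_or_lt with h | h
    · simp [← h]
    · have hs : Real.sin θ₀ = 0 := by
        have : r₀ * Real.sin θ₀ = 0 := hy₀ ▸ hy
        simpa [h.ne'] using this
      have hθ₀ : θ₀ = 0 := by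
        rcases h₀l.eq_or_lt with h' | h'
        · exact h'.symm
        · exact absurd hs (Real.sin_pos_of_pos_of_lt_pi h' (by linarith)).ne'
      simp [hθ₀, h.le]

/-- **The central surface of Gay–Kirby's genus-`0` trisection of `S⁴` is the `2`-sphere
`{z = 0} ∩ S⁴`.** [cite: GayKirby2016, §2 (arXiv p. 5), first example] -/
theorem iInter_sphereSector_eq :
    (⋂ j, sphereSector j) = {x : Metric.sphere (0 : EuclideanSpace ℝ (Fin 5)) 1 |
      (x : EuclideanSpace ℝ (Fin 5)) 0 = 0 ∧ (x : EuclideanSpace ℝ (Fin 5)) 1 = 0} := by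
  ext x
  rw [mem_iInter, mem_setOf_eq]
  exact ⟨eq_zero_of_forall_mem_sphereSector, fun h j => mem_sphereSector_of_eq_zero h.1 h.2 j⟩

/-- The embedding `ℝ³ → ℝ⁵ = ℂ × ℝ³`, `y ↦ (0, y)`. [folklore] -/
private def tailEmb (y : EuclideanSpace ℝ (Fin 3)) : EuclideanSpace ℝ (Fin 5) :=
  !₂[0, 0, y 0, y 1, y 2]

/-- `(0, y)₀ = 0`. [folklore] -/
@[simp] private theorem tailEmb_apply_zero (y : EuclideanSpace ℝ (Fin 3)) : tailEmb y 0 = 0 := rfl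
/-- `(0, y)₁ = 0`. [folklore] -/
@[simp] private theorem tailEmb_apply_one (y : EuclideanSpace ℝ (Fin 3)) : tailEmb y 1 = 0 := rfl
/-- `(0, y)₂ = y₀`. [folklore] -/
@[simp] private theorem tailEmb_apply_two (y : EuclideanSpace ℝ (Fin 3)) : tailEmb y 2 = y 0 := rfl
/-- `(0, y)₃ = y₁`. [folklore] -/
@[simp] private theorem tailEmb_apply_three (y : EuclideanSpace ℝ (Fin 3)) : tailEmb y 3 = y 1 := rfl
/-- `(0, y)₄ = y₂`. [folklore] -/
@[simp] private theorem tailEmb_apply_four (y : EuclideanSpace ℝ (Fin 3)) : tailEmb y 4 = y 2 := rfl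

/-- `y ↦ (0, y)` is an isometry `ℝ³ → ℝ⁵`. [folklore] -/
private theorem isometry_tailEmb : Isometry tailEmb :=
  Isometry.of_dist_eq fun x y => by
    simp [EuclideanSpace.dist_eq, Fin.sum_univ_five, Fin.sum_univ_three]

/-- `‖(0, y)‖ = ‖y‖`. [folklore] -/
private theorem norm_tailEmb (y : EuclideanSpace ℝ (Fin 3)) : ‖tailEmb y‖ = ‖y‖ := by
  simp [EuclideanSpace.norm_eq, Fin.sum_univ_five, Fin.sum_univ_three]

/-- The image of the unit `2`-sphere of `ℝ³` under `y ↦ (0, y)` is `{v ∈ S⁴ | v₀ = v₁ = 0}`. [folklore] -/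
private theorem image_tailEmb_sphere :
    tailEmb '' Metric.sphere (0 : EuclideanSpace ℝ (Fin 3)) 1 =
      {v | v ∈ Metric.sphere (0 : EuclideanSpace ℝ (Fin 5)) 1 ∧ v 0 = 0 ∧ v 1 = 0} := by
  ext v
  simp only [mem_image, mem_sphere_iff_norm, sub_zero, mem_setOf_eq]
  constructor
  · rintro ⟨y, hy, rfl⟩
    exact ⟨by rw [norm_tailEmb, hy], rfl, rfl⟩
  · rintro ⟨hv, h0, h1⟩
    refine ⟨!₂[v 2, v 3, v 4], ?_, ?_⟩
    · have h : tailEmb !₂[v 2, v 3, v 4] = v := by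
        ext i
        fin_cases i <;> simp [tailEmb, h0, h1]
      rw [← norm_tailEmb, h, hv]
    · ext i
      fin_cases i <;> simp [tailEmb, h0, h1]

/-- The central surface, pushed into `ℝ⁵`, is `{v ∈ S⁴ | v₀ = v₁ = 0}`.
[cite: GayKirby2016, §2 (arXiv p. 5), first example] -/
theorem image_val_iInter_sphereSector :
    Subtype.val '' (⋂ j, sphereSector j) =
      {v | v ∈ Metric.sphere (0 : EuclideanSpace ℝ (Fin 5)) 1 ∧ v 0 = 0 ∧ v 1 = 0} := by
  ext v
  constructor
  · rintro ⟨x, hx, rfl⟩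
    exact ⟨x.2, eq_zero_of_forall_mem_sphereSector (mem_iInter.1 hx)⟩
  · rintro ⟨hv, h0, h1⟩
    exact ⟨⟨v, hv⟩, mem_iInter.2 fun j => mem_sphereSector_of_eq_zero h0 h1 j, rfl⟩

/-- **The central surface `F = X₀ ∩ X₁ ∩ X₂ ≅ S²` of the genus-`0` trisection of `S⁴` is simply
connected** (`π₁(S²) = 1`, Hatcher Prop. 1.14, via `simplyConnectedSpace_euclideanSphere`).
[cite: GayKirby2016, §2 (arXiv p. 5), first example] -/
theorem isSimplyConnected_iInter_sphereSector : IsSimplyConnected (⋂ j, sphereSector j) := by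
  rw [← Topology.IsEmbedding.subtypeVal.isSimplyConnected_image, image_val_iInter_sphereSector,
    ← image_tailEmb_sphere, isometry_tailEmb.isEmbedding.isSimplyConnected_image]
  exact simplyConnectedSpace_euclideanSphere (n := 2) le_rfl

/-- The central surface of Gay–Kirby's sectors, as a space, is simply connected (it is the
`2`-sphere `{z = 0} ∩ S⁴`). [cite: GayKirby2016, §2 (arXiv p. 5), first example] -/
instance simplyConnectedSpace_centralSurface_sphereSector :
    SimplyConnectedSpace (centralSurface sphereSector) :=
  isSimplyConnected_iInter_sphereSector

/-- The base point `e₂ = (0, 0, 1, 0, 0)` of the central `2`-sphere. [cite: GayKirby2016, §2 (arXiv p. 5), first example] -/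
def sphereSector_basePoint : centralSurface sphereSector :=
  ⟨⟨EuclideanSpace.single 2 1, by simp⟩,
    mem_iInter.2 fun j => mem_sphereSector_of_eq_zero (by simp) (by simp) j⟩

/-- **The marking of the genus-`0` trisection of `S⁴`**: `S_0 = {1} ≃* π₁(S², e₂) = {1}`
(Abrams–Gay–Kirby 2018, Thm. 5: "The unique `(0, 0)`-trisection of `{1}` maps to the unique
`(0, 0)`-trisection of `S⁴`"). [cite: AbramsGayKirby2018, Thm. 5 (p. 1541)] -/
def sphereSector_marking : SurfaceGroup 0 ≃* FundamentalGroup (centralSurface sphereSector) sphereSector_basePoint :=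
  letI : Unique (SurfaceGroup 0) := uniqueOfSubsingleton 1
  letI : Unique (FundamentalGroup (centralSurface sphereSector) sphereSector_basePoint) := uniqueOfSubsingleton 1
  MulEquiv.ofUnique

end GayKirby

/-- **(d′) from a *marked* genus-`0` trisection and stabilisation (c′) alone.**  If the round `S⁴`
has a balanced `(0, 0)`-trisection with corners whose central surface carries a base point and a
marking `S_0 ≃* π₁(F, x₀)` (i.e. `π₁(F, x₀) = 1`), then (c′) `exists_stabilized_gkTrisection`
gives `sphere_gkTrisections`: induction on `m` exactly as in `sphere_gkTrisections_of_genusZero`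
(genus-`0` kernels `= trivialKernels`, `trivialKernels.stabilize = s4Kernels`, re-marking turns
`Iso` into `=`), the orientation of `S⁴` being `isOrientable_sphere_holds`.
[cite: GayKirby2016, §2 (arXiv p. 5), first three examples; Def. 8 and Lemma 10 (arXiv p. 4)]
[cite: AbramsGayKirby2018, Thm. 5 (p. 1541)] -/
theorem sphere_gkTrisections_of_marked_genusZero
    (h0 : ∃ (S : Fin 3 → Set (Metric.sphere (0 : EuclideanSpace ℝ (Fin 5)) 1))
      (_ : IsBalancedGKTrisection (Metric.sphere (0 : EuclideanSpace ℝ (Fin 5)) 1) 0 0 S)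
      (x₀ : centralSurface S), Nonempty (SurfaceGroup 0 ≃* FundamentalGroup (centralSurface S) x₀))
    (hc : exists_stabilized_gkTrisection.{0}) : sphere_gkTrisections := by
  obtain ⟨o⟩ := isOrientable_sphere_holds 4
  intro m
  induction m with
  | zero =>
    obtain ⟨S₀, hS₀, x₀, ⟨μ₀⟩⟩ := h0
    obtain ⟨S₁, hS₁, x₁, μ₁, hiso⟩ :=
      hc (Metric.sphere (0 : EuclideanSpace ℝ (Fin 5)) 1) o 0 0 S₀ hS₀ x₀ μ₀
    rw [groupGKTrisectionOf_genus_zero, trivialKernels_stabilize] at hiso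
    exact ⟨S₁, hS₁, x₁, μ₁, hiso⟩
  | succ m ih =>
    obtain ⟨S, hS, x₀, μ, hiso⟩ := ih
    obtain ⟨μ', hμ'⟩ := exists_marking_groupGKTrisectionOf_eq hS x₀ μ hiso
    obtain ⟨S', hS', x₀', μ'', hiso'⟩ :=
      hc (Metric.sphere (0 : EuclideanSpace ℝ (Fin 5)) 1) o (3 + 3 * m) (1 + m) S hS x₀ μ'
    rw [hμ'] at hiso'
    exact ⟨S', hS', x₀', μ'', hiso'⟩

/-- **(d′) from Gay–Kirby's explicit genus-`0` trisection and stabilisation (c′)** — the marking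
fact (g′) is not needed, the central surface of the explicit sectors being the simply connected
`2`-sphere `{z = 0}` (`GayKirby.sphereSector_marking`).  This is the printed derivation of the standard
trisections of `S⁴` (Gay–Kirby 2016, §2: genus `0`, then "Stabilizing the genus `0` trisection of
`S⁴` gives a genus `3` trisection", then connected sums with it), conditional only on the two
geometric named facts `sphereSector_isBalancedGKTrisection` (GK §2, first example) and
`exists_stabilized_gkTrisection` (GK Lemma 10 with AGK Thm. 5).
[cite: GayKirby2016, §2 (arXiv p. 5), first three examples; Def. 8 and Lemma 10 (arXiv p. 4)]
[cite: AbramsGayKirby2018, Thm. 5 (p. 1541)] -/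
theorem sphere_gkTrisections_of_sphereSector_of_stabilization
    (h0 : sphereSector_isBalancedGKTrisection) (hc : exists_stabilized_gkTrisection.{0}) :
    sphere_gkTrisections :=
  sphere_gkTrisections_of_marked_genusZero ⟨_, h0, GayKirby.sphereSector_basePoint, ⟨GayKirby.sphereSector_marking⟩⟩ hc


/-! ### The three clauses of `sphereSector_isBalancedGKTrisection`; clause (i) proved -/

namespace GayKirby

/-- **Clause (i) of Gay–Kirby's Def. 1 (its preamble: "a decomposition of `X` into three submanifolds
`X = X_1 ∪ X_2 ∪ X_3`") for the explicit sectors: `S⁴ = X₀ ∪ X₁ ∪ X₂`.**  Write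
`(x₀, x₁) = r (cos θ, sin θ)` with `r = |z| ≥ 0` and `θ ∈ [0, 2π]` (`θ = arg z` or `arg z + 2π`);
then `θ` lies in one of the three arcs `[2πj/3, 2π(j+1)/3]`.
[cite: GayKirby2016, §2 (arXiv p. 5), first example; Def. 1 (arXiv p. 3)] -/
theorem iUnion_sphereSector_eq_univ : (⋃ j, sphereSector j) = univ := by
  refine eq_univ_of_forall fun x => ?_
  have hπ : 0 < π := Real.pi_pos
  -- polar coordinates of `z = x₀ + i x₁` with `θ ∈ [0, 2π]`
  obtain ⟨r, θ, hr, hθ0, hθ1, ha, hb⟩ : ∃ r θ : ℝ, 0 ≤ r ∧ 0 ≤ θ ∧ θ ≤ 2 * π ∧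
      (x : EuclideanSpace ℝ (Fin 5)) 0 = r * Real.cos θ ∧
      (x : EuclideanSpace ℝ (Fin 5)) 1 = r * Real.sin θ := by
    set z : ℂ := ⟨(x : EuclideanSpace ℝ (Fin 5)) 0, (x : EuclideanSpace ℝ (Fin 5)) 1⟩ with hz
    have ha : ‖z‖ * Real.cos (Complex.arg z) = (x : EuclideanSpace ℝ (Fin 5)) 0 :=
      Complex.norm_mul_cos_arg z
    have hb : ‖z‖ * Real.sin (Complex.arg z) = (x : EuclideanSpace ℝ (Fin 5)) 1 :=
      Complex.norm_mul_sin_arg z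
    rcases le_or_gt 0 (Complex.arg z) with h | h
    · exact ⟨‖z‖, Complex.arg z, norm_nonneg _, h, (Complex.arg_le_pi z).trans (by linarith),
        ha.symm, hb.symm⟩
    · refine ⟨‖z‖, Complex.arg z + 2 * π, norm_nonneg _, ?_, ?_, ?_, ?_⟩
      · linarith [Complex.neg_pi_lt_arg z]
      · linarith
      · rw [Real.cos_add_two_pi]; exact ha.symm
      · rw [Real.sin_add_two_pi]; exact hb.symm
  simp only [mem_iUnion]
  rcases le_total θ (2 * π / 3) with h1 | h1
  · refine ⟨0, r, θ, hr, ?_, ?_, ha, hb⟩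
    · simpa using hθ0
    · simp only [Fin.val_zero, Nat.cast_zero, zero_add, mul_one]; exact h1
  rcases le_total θ (2 * π * 2 / 3) with h2 | h2
  · refine ⟨1, r, θ, hr, ?_, ?_, ha, hb⟩
    · simp only [Fin.val_one, Nat.cast_one, mul_one]; exact h1
    · simp only [Fin.val_one, Nat.cast_one]; linarith
  · refine ⟨2, r, θ, hr, ?_, ?_, ha, hb⟩
    · simp only [Fin.val_two, Nat.cast_ofNat]; exact h2
    · simp only [Fin.val_two, Nat.cast_ofNat]; linarith

/-! #### The double intersections `X_i ∩ X_{i+1}` are closed half great-`3`-spheres -/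

/-- Rotating the frame by `β`: if `(x₀, x₁) = r (cos θ, sin θ)` then
`-sin β · x₀ + cos β · x₁ = r sin (θ - β)` (the signed distance to the line at angle `β`). [folklore] -/
private theorem neg_sin_mul_add_cos_mul (r θ β : ℝ) :
    -Real.sin β * (r * Real.cos θ) + Real.cos β * (r * Real.sin θ) = r * Real.sin (θ - β) := by
  rw [Real.sin_sub]; ring

/-- **Two adjacent angular sectors meet along their common ray.**  If a point `(x₀, x₁)` of the
plane has polar representations `r (cos θ, sin θ)` with `β - 2π/3 ≤ θ ≤ β` and
`r' (cos θ', sin θ')` with `sin (θ' - β) ≥ 0` (e.g. `β ≤ θ' ≤ β + 2π/3`), `r, r' ≥ 0`, then it lies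
on the closed ray at angle `β`. [folklore] -/
theorem exists_ray_of_mem_adjacent_sectors {x₀ x₁ r r' θ θ' β : ℝ} (hr : 0 ≤ r) (hr' : 0 ≤ r')
    (h₁ : β - 2 * π / 3 ≤ θ) (h₂ : θ ≤ β) (hpos : 0 ≤ Real.sin (θ' - β))
    (hx₀ : x₀ = r * Real.cos θ) (hx₁ : x₁ = r * Real.sin θ)
    (hx₀' : x₀ = r' * Real.cos θ') (hx₁' : x₁ = r' * Real.sin θ') :
    ∃ s : ℝ, 0 ≤ s ∧ x₀ = s * Real.cos β ∧ x₁ = s * Real.sin β := by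
  have hπ : 0 < π := Real.pi_pos
  have hd : -Real.sin β * x₀ + Real.cos β * x₁ = r * Real.sin (θ - β) := by
    rw [hx₀, hx₁, neg_sin_mul_add_cos_mul]
  have hd' : -Real.sin β * x₀ + Real.cos β * x₁ = r' * Real.sin (θ' - β) := by
    rw [hx₀', hx₁', neg_sin_mul_add_cos_mul]
  have hθβl : -π < θ - β := by linarith
  have hθβu : θ - β ≤ 0 := by linarith
  have hneg : Real.sin (θ - β) ≤ 0 := Real.sin_nonpos_of_nonpos_of_neg_pi_le hθβu hθβl.le
  have hzero : r * Real.sin (θ - β) = 0 :=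
    le_antisymm (mul_nonpos_iff.mpr (Or.inl ⟨hr, hneg⟩)) (hd ▸ hd' ▸ mul_nonneg hr' hpos)
  rcases mul_eq_zero.mp hzero with h | h
  · exact ⟨0, le_rfl, by simp [hx₀, h], by simp [hx₁, h]⟩
  · have hθβ : θ = β := by
      rcases hθβu.eq_or_lt with h' | h'
      · linarith
      · exact absurd h (Real.sin_neg_of_neg_of_neg_pi_lt h' hθβl).ne
    exact ⟨r, hr, by rw [hx₀, hθβ], by rw [hx₁, hθβ]⟩

/-- **`X₀ ∩ X₁` is the closed half great-`3`-sphere at angle `2π/3`**: the points of `S⁴` with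
`(x₀, x₁) = s (cos (2π/3), sin (2π/3))`, `s ≥ 0`. [cite: GayKirby2016, §2 (arXiv p. 5), first example] -/
theorem sphereSector_zero_inter_one :
    sphereSector 0 ∩ sphereSector 1 = {x : Metric.sphere (0 : EuclideanSpace ℝ (Fin 5)) 1 | ∃ s : ℝ,
      0 ≤ s ∧ (x : EuclideanSpace ℝ (Fin 5)) 0 = s * Real.cos (2 * π / 3) ∧
        (x : EuclideanSpace ℝ (Fin 5)) 1 = s * Real.sin (2 * π / 3)} := by
  have hπ : 0 < π := Real.pi_pos
  ext x
  simp only [mem_inter_iff, mem_sphereSector_iff, mem_setOf_eq, Fin.val_zero, Nat.cast_zero,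
    Fin.val_one, Nat.cast_one, mul_zero, zero_div, zero_add, mul_one]
  constructor
  · rintro ⟨⟨r, θ, hr, hθl, hθu, hx0, hx1⟩, ⟨r', θ', hr', hθl', hθu', hx0', hx1'⟩⟩
    refine exists_ray_of_mem_adjacent_sectors hr hr' (by linarith) hθu ?_ hx0 hx1 hx0' hx1'
    exact Real.sin_nonneg_of_nonneg_of_le_pi (by linarith) (by linarith)
  · rintro ⟨s, hs, hx0, hx1⟩
    exact ⟨⟨s, 2 * π / 3, hs, by linarith, le_rfl, hx0, hx1⟩,
      ⟨s, 2 * π / 3, hs, le_rfl, by linarith, hx0, hx1⟩⟩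

/-- **`X₁ ∩ X₂` is the closed half great-`3`-sphere at angle `4π/3`.** [cite: GayKirby2016, §2 (arXiv p. 5), first example] -/
theorem sphereSector_one_inter_two :
    sphereSector 1 ∩ sphereSector 2 = {x : Metric.sphere (0 : EuclideanSpace ℝ (Fin 5)) 1 | ∃ s : ℝ,
      0 ≤ s ∧ (x : EuclideanSpace ℝ (Fin 5)) 0 = s * Real.cos (2 * π * 2 / 3) ∧
        (x : EuclideanSpace ℝ (Fin 5)) 1 = s * Real.sin (2 * π * 2 / 3)} := by
  have hπ : 0 < π := Real.pi_pos
  ext x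
  simp only [mem_inter_iff, mem_sphereSector_iff, mem_setOf_eq, Fin.val_one, Nat.cast_one,
    Fin.val_two, Nat.cast_ofNat, mul_one]
  constructor
  · rintro ⟨⟨r, θ, hr, hθl, hθu, hx0, hx1⟩, ⟨r', θ', hr', hθl', hθu', hx0', hx1'⟩⟩
    refine exists_ray_of_mem_adjacent_sectors hr hr' (by linarith) (by linarith) ?_ hx0 hx1 hx0' hx1'
    exact Real.sin_nonneg_of_nonneg_of_le_pi (by linarith) (by linarith)
  · rintro ⟨s, hs, hx0, hx1⟩
    exact ⟨⟨s, 2 * π * 2 / 3, hs, by linarith, by linarith, hx0, hx1⟩,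
      ⟨s, 2 * π * 2 / 3, hs, by linarith, by linarith, hx0, hx1⟩⟩

/-- **`X₂ ∩ X₀` is the closed half great-`3`-sphere at angle `0`** (`= 2π`): the points with
`x₁ = 0 ≤ x₀`. [cite: GayKirby2016, §2 (arXiv p. 5), first example] -/
theorem sphereSector_two_inter_zero :
    sphereSector 2 ∩ sphereSector 0 = {x : Metric.sphere (0 : EuclideanSpace ℝ (Fin 5)) 1 |
      0 ≤ (x : EuclideanSpace ℝ (Fin 5)) 0 ∧ (x : EuclideanSpace ℝ (Fin 5)) 1 = 0} := by
  have hπ : 0 < π := Real.pi_pos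
  ext x
  simp only [mem_inter_iff, mem_sphereSector_iff, mem_setOf_eq, Fin.val_zero, Nat.cast_zero,
    Fin.val_two, Nat.cast_ofNat, mul_zero, zero_div, zero_add, mul_one]
  constructor
  · rintro ⟨⟨r, θ, hr, hθl, hθu, hx0, hx1⟩, ⟨r', θ', hr', hθl', hθu', hx0', hx1'⟩⟩
    -- sector 2: `θ ∈ [4π/3, 2π]`, boundary ray `β = 2π`; sector 0: `θ' ∈ [0, 2π/3]`
    have hpos : 0 ≤ Real.sin (θ' - 2 * π) := by
      rw [Real.sin_sub_two_pi]
      exact Real.sin_nonneg_of_nonneg_of_le_pi hθl' (by linarith)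
    obtain ⟨s, hs, h0, h1⟩ := exists_ray_of_mem_adjacent_sectors (β := 2 * π) hr hr'
      (by linarith) (by linarith) hpos hx0 hx1 hx0' hx1'
    rw [Real.cos_two_pi, mul_one] at h0
    rw [Real.sin_two_pi, mul_zero] at h1
    exact ⟨h0 ▸ hs, h1⟩
  · rintro ⟨hx0, hx1⟩
    refine ⟨⟨(x : EuclideanSpace ℝ (Fin 5)) 0, 2 * π, hx0, by linarith, by linarith, ?_, ?_⟩,
      ⟨(x : EuclideanSpace ℝ (Fin 5)) 0, 0, hx0, le_rfl, by linarith, ?_, ?_⟩⟩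
    · rw [Real.cos_two_pi, mul_one]
    · rw [Real.sin_two_pi, mul_zero, hx1]
    · rw [Real.cos_zero, mul_one]
    · rw [Real.sin_zero, mul_zero, hx1]

end GayKirby

/-- **Clause (ii) of `Literature.Topology.FourManifolds.IsGKTrisection` (Gay–Kirby's Def. 1, first bullet) for the explicit
sectors of `S⁴` (named fact; DISCHARGED in `SphereTrisectionsSectors.lean`,
`Literature.Topology.FourManifolds.sphereSector_sectors_holds`).**  Each sector
`X_j = {2πj/3 ≤ θ ≤ 2π(j+1)/3}` is the image of a compact connected smooth `4`-manifold with
boundary `W ≅ B⁴` (one `0`-handle, no `1`-handles: `HasHandleDecomposition 3 W (handleCount 1 0)`)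
under a topological embedding which is a `C^∞` immersion off the central surface
`F = {z = 0} ∩ S⁴` and has the corner model (`IsCornerAt`) at the points over `F`, with
`X_j ∩ X_l ⊆ e(∂W)` — literally clause (ii) of `Literature.Topology.FourManifolds.IsGKTrisection` for `S := GayKirby.sphereSector`,
`k_j = 0`.  Print (GK Def. 1, first bullet): "For each `i = 1,2,3`, there is a diffeomorphism
`φ_i : X_i → Z_k`", where `Z_k = ♮^k (S¹ × B³)`; here `k = 0`, i.e. `Z_0 = B⁴`, for the pieces
`X_j` of §2's first example; the verification with the corner charts
`cornerFold ∘ A_j⁻¹ ∘ Ψ` and the Morse function `1 - Im z` on the hemisphere model is spelled out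
in the docstring of `Literature.Topology.FourManifolds.IsGKTrisection` ("Non-vacuity").  Formalised in
`SphereTrisectionsSectors.lean` with `W` the closed unit `4`-ball and `e = GayKirby.sectorMap (2πj/3)`
an explicit parametrisation of `X_j` (corner charts `GayKirby.ballCornerChart`,
`GayKirby.sphCornerChart`). [cite: GayKirby2016, §2 (arXiv p. 5), first example; Def. 1, first bullet (arXiv p. 3)] -/
def sphereSector_sectors : Prop :=
  ∀ i : Fin 3, ∃ (W : Type) (_ : TopologicalSpace W) (_ : ChartedSpace (EuclideanHalfSpace 4) W)
    (e : W → Metric.sphere (0 : EuclideanSpace ℝ (Fin 5)) 1),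
    IsManifold (𝓡∂ 4) ∞ W ∧ CompactSpace W ∧ ConnectedSpace W ∧
      HasHandleDecomposition 3 W (handleCount 1 0) ∧
      Topology.IsEmbedding e ∧ range e = GayKirby.sphereSector i ∧
      (∀ w, e w ∉ (⋂ l, GayKirby.sphereSector l) → Manifold.IsImmersionAt (𝓡∂ 4) (𝓡 4) ∞ e w) ∧
      (∀ w, e w ∈ (⋂ l, GayKirby.sphereSector l) → IsCornerAt e w) ∧
      ∀ j, j ≠ i → GayKirby.sphereSector i ∩ GayKirby.sphereSector j ⊆ e '' (𝓡∂ 4).boundary W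

/-- **Clause (iii) of `Literature.Topology.FourManifolds.IsGKTrisection` (Gay–Kirby's Def. 1, second bullet and the paragraph
following it) for the explicit sectors of `S⁴` (named fact; DISCHARGED in
`SphereTrisectionsHandlebodies.lean`, `Literature.Topology.FourManifolds.sphereSector_handlebodies_holds`).**  Each double
intersection `X_i ∩ X_j = {θ = 2π(j+1)/3 (resp. 0)} ∪ F` (`i ≠ j`), a closed hemisphere of the
great `3`-sphere `S⁴ ∩ (ℝ e^{iθ} × ℝ³)`, is the image of a compact connected smooth `3`-manifold
with boundary `H ≅ B³` (one `0`-handle, `g = 0` `1`-handles) under a smooth embedding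
`h : H → S⁴` with `h(∂H) = F = X₀ ∩ X₁ ∩ X₂` (`= {z = 0} ∩ S⁴`,
`GayKirby.iInter_sphereSector_eq`) — literally clause (iii) of `Literature.Topology.FourManifolds.IsGKTrisection` for
`S := GayKirby.sphereSector`, `g = 0`.  Print (GK, paragraph following Def. 1): "consider the
handlebodies `H_{ij} = X_i ∩ X_j` and the central genus `g` surface
`F_g = X_1 ∩ X_2 ∩ X_3 = ∂H_{ij}`" (Def. 1, second bullet: "`φ_i(X_i ∩ X_{i+1}) = Y⁻_{k,g}` and
`φ_i(X_i ∩ X_{i-1}) = Y⁺_{k,g}`"); for §2's first example `g = 0` and, as in the docstring of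
`Literature.Topology.FourManifolds.IsGKTrisection`, `H_{j,j+1}` is the image of the closed unit `3`-ball under the inverse
stereographic projection of the great `3`-sphere from the antipode `(-e^{iθ}, 0)` — formalised in
`SphereTrisectionsHandlebodies.lean` (`GayKirby.sliceMap`).
[cite: GayKirby2016, §2 (arXiv p. 5), first example; Def. 1, second bullet and the following paragraph (arXiv p. 3)] -/
def sphereSector_handlebodies : Prop :=
  ∀ i j : Fin 3, i ≠ j → ∃ (H : Type) (_ : TopologicalSpace H) (_ : ChartedSpace (EuclideanHalfSpace 3) H)
    (h : H → Metric.sphere (0 : EuclideanSpace ℝ (Fin 5)) 1),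
    IsManifold (𝓡∂ 3) ∞ H ∧ CompactSpace H ∧ ConnectedSpace H ∧
      HasHandleDecomposition 2 H (handleCount 1 0) ∧
      Manifold.IsSmoothEmbedding (𝓡∂ 3) (𝓡 4) ∞ h ∧
      range h = GayKirby.sphereSector i ∩ GayKirby.sphereSector j ∧
      h '' (𝓡∂ 3).boundary H = ⋂ l, GayKirby.sphereSector l

/-- **Assembly of the genus-`0` fact from its clauses**: clause (i) is
`GayKirby.iUnion_sphereSector_eq_univ` (proved), clauses (ii), (iii) are the named facts
`sphereSector_sectors`, `sphereSector_handlebodies` (discharged in `SphereTrisectionsSectors.lean`,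
`SphereTrisectionsHandlebodies.lean`). [cite: GayKirby2016, §2 (arXiv p. 5), first example; Def. 1 (arXiv p. 3)] -/
theorem sphereSector_isBalancedGKTrisection_of (h₂ : sphereSector_sectors)
    (h₃ : sphereSector_handlebodies) : sphereSector_isBalancedGKTrisection :=
  ⟨GayKirby.iUnion_sphereSector_eq_univ, h₂, h₃⟩

/-- Conversely the genus-`0` fact contains the two clauses (so the decomposition is exact).
[cite: GayKirby2016, Def. 1 (arXiv p. 3)] -/
theorem sphereSector_isBalancedGKTrisection.clauses (h : sphereSector_isBalancedGKTrisection) :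
    sphereSector_sectors ∧ sphereSector_handlebodies :=
  ⟨h.2.1, h.2.2⟩

/-- **(d′) from the three remaining geometric inputs**: clauses (ii), (iii) for Gay–Kirby's sectors
and the stabilisation fact (c′) (with (ii), (iii) discharged: `sphere_gkTrisections_of_stabilization`
in `SphereTrisectionsSectors.lean`). [cite: GayKirby2016, §2 (arXiv p. 5), first three examples; Def. 8 and Lemma 10 (arXiv p. 4)] -/
theorem sphere_gkTrisections_of_clauses (h₂ : sphereSector_sectors) (h₃ : sphereSector_handlebodies)
    (hc : exists_stabilized_gkTrisection.{0}) : sphere_gkTrisections :=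
  sphere_gkTrisections_of_sphereSector_of_stabilization (sphereSector_isBalancedGKTrisection_of h₂ h₃) hc

end Literature.Topology.FourManifolds

end
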